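import Literature.Topology.FourManifolds.LickorishWallaceLeaves
import Literature.Topology.FourManifolds.OneHandleStepExists
import HarnessLib

/-!
# Handlebodies of the same genus and orientability are diffeomorphic (discharge under its own name)

Topic `Literature/Topology/FourManifolds`. The named fact `IsHandlebody.nonempty_diffeomorph`
(`LickorishWallaceHandlebodies.lean`; Kosinski 1993, VI (11.4)(c): "genus and orientability form a
complete set of diffeomorphism invariants" of handlebodies) is proved in the tree in assembled form:
`IsHandlebody.nonempty_diffeomorph_of_oneHandle` (`LickorishWallaceLeaves.lean`) reduces it to the
uniqueness of attaching one `1`-handle, `oneHandle_nonempty_diffeomorph`, which is discharged as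
`oneHandle_nonempty_diffeomorph_holds` (`OneHandleStepExists.lean`); the users
(`HandlebodyKernelExtensionGenusOne.lean`, `ReducibleTrisectionSplitting.lean`) apply the pair. No
theorem of type `IsHandlebody.nonempty_diffeomorph` was recorded; this leaf records the discharge
under the fact's own name. No new definitions, no new named facts.
-/

namespace Literature.Topology.FourManifolds

universe u

/-- **Kosinski 1993, VI (11.4)(c) — handlebodies are classified by genus and orientability,
discharged**: the named fact `IsHandlebody.nonempty_diffeomorph` holds, by
`IsHandlebody.nonempty_diffeomorph_of_oneHandle` and the landed uniqueness of one `1`-handle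
attachment `oneHandle_nonempty_diffeomorph_holds`. [cite: Kosinski1993, VI (11.4)(c)] -/
theorem IsHandlebody.nonempty_diffeomorph_holds : IsHandlebody.nonempty_diffeomorph.{u} :=
  IsHandlebody.nonempty_diffeomorph_of_oneHandle oneHandle_nonempty_diffeomorph_holds

end Literature.Topology.FourManifolds
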